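import Summits.QuantumFields.YangMills.Theorems.FluctuationComparisonRegPrIntLS2BetaResidualSubgroup
import Summits.QuantumFields.YangMills.Theorems.FluctuationComparisonRegPrIntLS2BetaResidualGaugeCentral
import HarnessLib

/-!
# S2β · LAPLACE — LIMIT-INST's GROUP-CHART ROW ON THE CARRIER OF RECORD: the (C3β″) chart packaged into `↥(residualSubgroup F hJK) × SU(2)^{pivots}`
# (seam GAP 4 (b) of the docking design: the centre of `SU(2)` is `{±1}`, so «residual AND close to `1`» ⇒ «rooted»)

Cell `ym3-torus` (rung R3: continuum `SU(2)` Yang–Mills on `T³` — NOT `d = 4`, NOT infinite volume, NOT a mass gap, NOT Clay); width seat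
`ym-ust-20520-w5` g13; def-free helper of the crux `stmt-QuantumFields-20520` (`--supports`, NOT a proof of it).  LIMIT-INST
(✓`…S2BetaLaplaceInst.laplaceLimit_of_charts`) takes a group chart `e : ℝ^{dZ} → ↥S × (PBond (F.P K) (K−J) → SU(2))` with `Continuous e`, `e 0 = 1`
and the openness row `he𝓝 : 𝓝 1 ≤ map e (𝓝 0)`; the chart of record (px21 g9 ✓`…S2BetaTubularChartAct.exists_tubularHaarChart_act`) delivers
`e : ℝ^{dZ} → (Site → SU(2)) × (PBond → SU(2))` with `∀ z, IsResidual (K−J) (e z).1` (print's ROOTED sheet, `= 1` on `T⁽ᴷ⁻ᴶ⁾`) and the local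
surjectivity clause `∀ s ∈ 𝓝 0, ∃ t ∈ 𝓝 (1,1), ∀ w ∈ t, IsResidual (K−J) w.1 → w ∈ e '' s`.  Packaging `(e z).1` into `S := residualSubgroup F hJK`
is px11 g9's ✓`residual_of_isResidual`; the openness row needs MORE: a residual transformation CLOSE TO `1` is rooted.  By px11's rooted decomposition
(✓`exists_central_isResidual_of_residual`: residual = central constant × rooted) this is the statement that the centre of `SU(2)` is `{±1}` — §1
(`coe_eq_one_or_eq_neg_one_of_forall_comm`, tested against `[[0,1],[−1,0]]` and `[[0,i],[i,0]]`); §2 the neighbourhood lemma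
`setOf_isResidual_mem_nhds_one`; §3 ★`groupChart_rows_of_rooted` — the three rows `Continuous e'`, `e' 0 = 1`, `𝓝 1 ≤ map e' (𝓝 0)` for
`e' z := (⟨(e z).1, _⟩, (e z).2)`.  HONEST SCOPE: group bookkeeping; proves no stub; LAPLACE ∕ S2β ∕ the crux 20520 NOT proved; `YM3TorusSU2` NOT proved;
the Yang–Mills mass gap (Clay) NOT proved.  Def-free; default heartbeats.
References: [BrockerTomDieck1985] Bröcker–tom Dieck, Representations of Compact Lie Groups, I (1.10) and IV (2.3) (centre of `SU(2)`);
[Balaban1987RG1] CMP 109 (1987) p. 256 (three sentences after (0.21)); [Balaban1985Variational] CMP 102 (1985) (4) p. 278.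
-/

noncomputable section

open MeasureTheory Filter Topology Set
open Literature.MathematicalPhysics.QuantumFieldTheory.Balaban1983to89
open Literature.MathematicalPhysics.QuantumFieldTheory.Balaban1983to89.T3ContinuumYM3Torus
open Literature.MathematicalPhysics.QuantumFieldTheory.Balaban1983to89.T3UnitLawDensityEML
open Literature.MathematicalPhysics.QuantumFieldTheory.Balaban1983to89.T3TiltDescent
open Summit.QuantumFields.YangMills.Theorems.FluctuationComparisonRegPrIntLS2BetaResidualGauge
open Literature.MathematicalPhysics.QuantumFieldTheory.Balaban1983to89.B15DeterminingSets (embIter)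
open Literature.MathematicalPhysics.QuantumFieldTheory.Balaban1983to89.B12GaugeOrbits021 (IsResidual)
open scoped Literature.MathematicalPhysics.QuantumFieldTheory.Balaban1983to89.T3OrbitAverage
open Summit.QuantumFields.YangMills.Theorems.FluctuationComparisonRegPrIntLS2BetaResidualSubgroup
open Summit.QuantumFields.YangMills.Theorems.FluctuationComparisonRegPrIntLS2BetaResidualGaugeRooted
open Summit.QuantumFields.YangMills.Theorems.FluctuationComparisonRegPrIntLS2BetaResidualGaugeCentral

namespace Summit.QuantumFields.YangMills.Theorems.FluctuationComparisonRegPrIntLS2BetaLaplaceInstGroupChart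

/-! ## §1 The centre of `SU(2)` is `{±1}` -/

/-- **THE CENTRE OF `SU(2)` IS `{±1}`**: an element of `SU(2)` commuting with every element is `1` or `−1` (as a matrix; tested against the two
elements `[[0,1],[−1,0]]`, `[[0,i],[i,0]]` and `det = 1`). [cite: BrockerTomDieck1985, IV (2.3)] -/
theorem coe_eq_one_or_eq_neg_one_of_forall_comm (c : Matrix.specialUnitaryGroup (Fin 2) ℂ)
    (hc : ∀ g : Matrix.specialUnitaryGroup (Fin 2) ℂ, c * g = g * c) :
    (c : Matrix (Fin 2) (Fin 2) ℂ) = 1 ∨ (c : Matrix (Fin 2) (Fin 2) ℂ) = -1 := by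
  have hJmem : (!![0, 1; -1, 0] : Matrix (Fin 2) (Fin 2) ℂ) ∈ Matrix.specialUnitaryGroup (Fin 2) ℂ := by
    rw [Matrix.mem_specialUnitaryGroup_iff, Matrix.mem_unitaryGroup_iff]
    constructor
    · ext i j
      fin_cases i <;> fin_cases j <;>
        simp [Matrix.mul_apply, Fin.sum_univ_two, Matrix.star_eq_conjTranspose, Matrix.conjTranspose_apply]
    · simp [Matrix.det_fin_two]
  have hKmem : (!![0, Complex.I; Complex.I, 0] : Matrix (Fin 2) (Fin 2) ℂ) ∈ Matrix.specialUnitaryGroup (Fin 2) ℂ := by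
    rw [Matrix.mem_specialUnitaryGroup_iff, Matrix.mem_unitaryGroup_iff]
    constructor
    · ext i j
      fin_cases i <;> fin_cases j <;>
        simp [Matrix.mul_apply, Fin.sum_univ_two, Matrix.star_eq_conjTranspose, Matrix.conjTranspose_apply]
    · simp [Matrix.det_fin_two]
  have hJ := congrArg Subtype.val (hc ⟨_, hJmem⟩)
  have hK := congrArg Subtype.val (hc ⟨_, hKmem⟩)
  simp only [Submonoid.coe_mul] at hJ hK
  set C : Matrix (Fin 2) (Fin 2) ℂ := (c : Matrix (Fin 2) (Fin 2) ℂ) with hCdef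
  have h01 := congrFun (congrFun hJ 0) 0
  have h00 := congrFun (congrFun hJ 0) 1
  have hK00 := congrFun (congrFun hK 0) 0
  simp [Matrix.mul_apply, Fin.sum_univ_two] at h01 h00 hK00
  -- `h01 : -C 0 1 = C 1 0`, `h00 : C 0 0 = C 1 1`, `hK00 : C 0 1 * I = I * C 1 0`
  have hdet : C.det = 1 := c.prop.2
  rw [Matrix.det_fin_two] at hdet
  have h1 : C 0 1 = C 1 0 := by
    have := hK00; rw [mul_comm] at this; exact mul_left_cancel₀ Complex.I_ne_zero this
  have hb : C 0 1 = 0 := by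
    have h2 : -C 0 1 = C 0 1 := h01.trans h1.symm
    linear_combination (-(1:ℂ)/2) * h2
  have hd : C 1 0 = 0 := by rw [← h1, hb]
  have ha : C 0 0 * C 0 0 = 1 := by
    have := hdet; rw [← h00, hb, hd] at this; simpa using this
  have ha' : C 0 0 = 1 ∨ C 0 0 = -1 := by
    have : (C 0 0 - 1) * (C 0 0 + 1) = 0 := by linear_combination ha
    rcases mul_eq_zero.mp this with h | h
    · left; linear_combination h
    · right; linear_combination h
  rcases ha' with ha1 | ha1
  · left
    ext i j
    fin_cases i <;> fin_cases j <;> simp [hb, hd, ha1, ← h00]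
  · right
    ext i j
    fin_cases i <;> fin_cases j <;> simp [hb, hd, ha1, ← h00]

/-- A central element of `SU(2)` which is not `−1` (as a matrix) is `1`. [cite: BrockerTomDieck1985, IV (2.3)] -/
theorem eq_one_of_forall_comm_of_coe_ne_neg_one {c : Matrix.specialUnitaryGroup (Fin 2) ℂ}
    (hc : ∀ g : Matrix.specialUnitaryGroup (Fin 2) ℂ, c * g = g * c) (hne : (c : Matrix (Fin 2) (Fin 2) ℂ) ≠ -1) : c = 1 :=
  Subtype.ext (((coe_eq_one_or_eq_neg_one_of_forall_comm c hc).resolve_right hne).trans (Submonoid.coe_one _).symm)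

/-! ## §2 A residual transformation close to `1` is rooted -/

section Residual

variable (F : T3Family) {J K : ℕ} (hJK : J ≤ K)

/-- **RESIDUAL AND CLOSE TO `1` ⇒ ROOTED**: inside the residual group `↥(residualSubgroup F hJK)` the transformations in print's rooted sheet
(`IsResidual (K − J)`: `= 1` on `T⁽ᴷ⁻ᴶ⁾`) form a NEIGHBOURHOOD of `1` — by the rooted decomposition (residual = central constant × rooted) and §1
(the central constant is `±1`; near `1` it is `1`). [cite: Balaban1987RG1, p.256 (three sentences after (0.21)); BrockerTomDieck1985, IV (2.3)] -/
theorem setOf_isResidual_mem_nhds_one :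
    {w : residualSubgroup F hJK | IsResidual (K - J) (w : Site (F.P K) 0 → Matrix.specialUnitaryGroup (Fin 2) ℂ)} ∈
      𝓝 (1 : residualSubgroup F hJK) := by
  rcases isEmpty_or_nonempty (Site (F.P K) (K - J)) with hE | ⟨⟨y₀⟩⟩
  · exact Filter.univ_mem' fun w y => (hE.false y).elim
  -- evaluation at one coarse site is continuous; `{g | ↑g ≠ -1}` is an open neighbourhood of `1`
  have hφ : Continuous fun w : residualSubgroup F hJK =>
      ((w : Site (F.P K) 0 → Matrix.specialUnitaryGroup (Fin 2) ℂ) (embIter (K - J) y₀) : Matrix (Fin 2) (Fin 2) ℂ) :=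
    ((continuous_apply (embIter (K - J) y₀)).comp continuous_subtype_val).subtype_val
  have hopen : IsOpen {w : residualSubgroup F hJK |
      ((w : Site (F.P K) 0 → Matrix.specialUnitaryGroup (Fin 2) ℂ) (embIter (K - J) y₀) : Matrix (Fin 2) (Fin 2) ℂ) ≠ -1} :=
    isOpen_ne_fun hφ continuous_const
  have hone : (1 : residualSubgroup F hJK) ∈ {w : residualSubgroup F hJK |
      ((w : Site (F.P K) 0 → Matrix.specialUnitaryGroup (Fin 2) ℂ) (embIter (K - J) y₀) : Matrix (Fin 2) (Fin 2) ℂ) ≠ -1} := by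
    show (((1 : residualSubgroup F hJK) : Site (F.P K) 0 → Matrix.specialUnitaryGroup (Fin 2) ℂ) (embIter (K - J) y₀) :
      Matrix (Fin 2) (Fin 2) ℂ) ≠ -1
    intro h
    have h00 := congrFun (congrFun h 0) 0
    simp at h00
    norm_num at h00
  refine Filter.mem_of_superset (hopen.mem_nhds hone) fun w hw => ?_
  -- rooted decomposition of the residual `w`: `w = c · r`, `r` rooted, `c` central; at the coarse site `y₀`, `w = c`
  obtain ⟨c, hc, hroot, -⟩ := exists_central_isResidual_of_residual F hJK w.2
  have hwc : ∀ y : Site (F.P K) (K - J), (w : Site (F.P K) 0 → Matrix.specialUnitaryGroup (Fin 2) ℂ) (embIter (K - J) y) = c := by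
    intro y
    have hy := hroot y
    simp only [Pi.mul_apply] at hy
    rw [inv_mul_eq_one] at hy
    exact hy.symm
  have hc1 : c = 1 := by
    refine eq_one_of_forall_comm_of_coe_ne_neg_one hc ?_
    rw [← hwc y₀]
    exact hw
  intro y
  rw [hwc y, hc1]

/-! ## §3 ★ The three group-chart rows of LIMIT-INST from the (C3β″) chart -/

/-- ★ **THE GROUP CHART OF RECORD, PACKAGED**: from a chart `e : Z → (Site → SU(2)) × (pivots → SU(2))` with rooted first component
(`∀ z, IsResidual (K − J) (e z).1`), continuous, `e 0 = 1`, and locally onto the rooted pairs near `(1,1)` (the clauses of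
✓`…S2BetaTubularChartAct.exists_tubularHaarChart_act` at `P := F.P K`, `k := K − J`), the chart
`e' z := (⟨(e z).1, residual_of_isResidual⟩, (e z).2)` into `↥(residualSubgroup F hJK) × (pivots → SU(2))` is continuous, `e' 0 = 1`, and OPEN AT THE
ORIGIN: `𝓝 1 ≤ map e' (𝓝 0)` — the rows `he he1 he𝓝` of ✓`…S2BetaLaplaceInst.laplaceLimit_of_charts` on the carrier of record.
[cite: Balaban1985Variational, Thm 1 (10) p.279; Balaban1987RG1, p.256; BrockerTomDieck1985, IV (2.3)] -/
theorem groupChart_rows_of_rooted {Z : Type*} [TopologicalSpace Z] [Zero Z] {C : Type*}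
    {e : Z → (Site (F.P K) 0 → Matrix.specialUnitaryGroup (Fin 2) ℂ) × (C → Matrix.specialUnitaryGroup (Fin 2) ℂ)}
    (he : Continuous e) (he1 : e 0 = 1) (hres : ∀ z, IsResidual (K - J) (e z).1)
    (hloc : ∀ s ∈ 𝓝 (0 : Z), ∃ t ∈ 𝓝 ((1 : Site (F.P K) 0 → Matrix.specialUnitaryGroup (Fin 2) ℂ),
        (1 : C → Matrix.specialUnitaryGroup (Fin 2) ℂ)), ∀ w ∈ t, IsResidual (K - J) w.1 → w ∈ e '' s) :
    Continuous (fun z => ((⟨(e z).1, residual_of_isResidual F hJK (hres z)⟩ : residualSubgroup F hJK), (e z).2)) ∧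
      (fun z => ((⟨(e z).1, residual_of_isResidual F hJK (hres z)⟩ : residualSubgroup F hJK), (e z).2)) 0 = 1 ∧
      𝓝 (1 : residualSubgroup F hJK × (C → Matrix.specialUnitaryGroup (Fin 2) ℂ)) ≤
        map (fun z => ((⟨(e z).1, residual_of_isResidual F hJK (hres z)⟩ : residualSubgroup F hJK), (e z).2)) (𝓝 0) := by
  refine ⟨((continuous_fst.comp he).subtype_mk _).prodMk (continuous_snd.comp he), ?_, ?_⟩
  · refine Prod.ext (Subtype.ext ?_) ?_
    · show (e 0).1 = ((1 : residualSubgroup F hJK) : Site (F.P K) 0 → Matrix.specialUnitaryGroup (Fin 2) ℂ)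
      rw [he1]; rfl
    · show (e 0).2 = 1
      rw [he1]; rfl
  · refine Filter.le_map fun s hs => ?_
    obtain ⟨t, ht, hts⟩ := hloc s hs
    -- the inclusion `ι : ↥S × pivots → (Site → SU(2)) × pivots` is continuous and maps `1 ↦ (1,1)`
    have hι : Continuous fun w : residualSubgroup F hJK × (C → Matrix.specialUnitaryGroup (Fin 2) ℂ) =>
        ((w.1 : Site (F.P K) 0 → Matrix.specialUnitaryGroup (Fin 2) ℂ), w.2) :=
      (continuous_subtype_val.comp continuous_fst).prodMk continuous_snd
    have ht' : (fun w : residualSubgroup F hJK × (C → Matrix.specialUnitaryGroup (Fin 2) ℂ) =>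
        ((w.1 : Site (F.P K) 0 → Matrix.specialUnitaryGroup (Fin 2) ℂ), w.2)) ⁻¹' t ∈
          𝓝 (1 : residualSubgroup F hJK × (C → Matrix.specialUnitaryGroup (Fin 2) ℂ)) :=
      hι.continuousAt.preimage_mem_nhds (by exact ht)
    have hN : {w : residualSubgroup F hJK × (C → Matrix.specialUnitaryGroup (Fin 2) ℂ) |
        IsResidual (K - J) (w.1 : Site (F.P K) 0 → Matrix.specialUnitaryGroup (Fin 2) ℂ)} ∈
          𝓝 (1 : residualSubgroup F hJK × (C → Matrix.specialUnitaryGroup (Fin 2) ℂ)) := by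
      have h := setOf_isResidual_mem_nhds_one F hJK
      have hca : ContinuousAt (Prod.fst : residualSubgroup F hJK × (C → Matrix.specialUnitaryGroup (Fin 2) ℂ) → residualSubgroup F hJK)
          (1 : residualSubgroup F hJK × (C → Matrix.specialUnitaryGroup (Fin 2) ℂ)) := continuous_fst.continuousAt
      have h' := hca.preimage_mem_nhds (by rw [Prod.fst_one]; exact h)
      exact h'
    refine Filter.mem_of_superset (Filter.inter_mem ht' hN) ?_
    rintro w ⟨hwt, hwN⟩
    obtain ⟨z, hz, hzw⟩ := hts _ hwt hwN
    refine ⟨z, hz, ?_⟩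
    have h1 : (e z).1 = (w.1 : Site (F.P K) 0 → Matrix.specialUnitaryGroup (Fin 2) ℂ) := congrArg Prod.fst hzw
    have h2 : (e z).2 = w.2 := congrArg Prod.snd hzw
    ext1
    · exact Subtype.ext h1
    · exact h2

end Residual

end Summit.QuantumFields.YangMills.Theorems.FluctuationComparisonRegPrIntLS2BetaLaplaceInstGroupChart

end
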